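import Literature.Algebra.Module.IdempotentMatrixFixedTensor
import Mathlib.LinearAlgebra.Dual.Defs
import HarnessLib

/-!
# The dual of a presented projective module: `(E·Rⁿ)^∨ ≅ Eᵀ·Rⁿ`

Topic `Algebra/Module`, namespace `Literature.Algebra.Module.IdempotentMatrix` (pure Mathlib linear algebra; constructions with bodies + proved
theorems; no named fact, no `sorry`, no instance, no notation).  Cell `hodgecm-mathlib`, F0/P6 «MOD», support for organ ST-4 of desk F0P6a-plan
(«`Hom_{𝒪_F}(A₀ ⊗ 𝔟₀, A ⊗ 𝔟) ≅ Hom_{𝒪_F}(A₀, A) ⊗ 𝔟₀⁻¹𝔟`»): ★ `AbelianSchemes/SerreTensorHomModuleSource` produces the factor `Eᵀ·Rⁿ` for the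
presentation `𝔟₀ = E·Rⁿ`; this file identifies it with the DUAL module `𝔟₀^∨ = Hom_R(𝔟₀, R)` (= `𝔟₀⁻¹` for an invertible ideal of a Dedekind
ring).  `--supports stmt-HodgeConjecture-24832`, count-neutral.  HC_CM is proved only modulo the 2 remaining named inputs (hLiu418, h413) until
rung 0 closes; this file discharges none of them.

## Mathematics

For an idempotent `E ∈ Mₙ(R)`, `Rⁿ = E·Rⁿ ⊕ (1−E)·Rⁿ`, so a linear form on `E·Rⁿ` is a linear form on `Rⁿ` killing `(1−E)·Rⁿ`, i.e. a row
vector `r` with `rE = r`, i.e. a column `rᵀ ∈ Fix(Eᵀ) = Eᵀ·Rⁿ`.  Explicitly `w ∈ Eᵀ·Rⁿ ↦ (v ↦ w·v)` (dot product) with inverse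
`φ ↦ Eᵀ·(φ(E e_k))_k` ([Bourbaki, Algebra II §2.6]; B. Conrad, *Gross–Zagier revisited* §7: `Hom(M ⊗_A 𝔐, N) = M^∨ ⊗ …` for finite projective `M`).

## Contents

* `dotPairing E : range (toLin' Eᵀ) →ₗ[R] Module.Dual R (range (toLin' E))` (`_apply`);
* `evalVec E : Module.Dual R (range (toLin' E)) →ₗ[R] (Fin n → R)` (`φ ↦ (φ (E e_k))_k`), `dualToRangeTranspose E := rangeProj Eᵀ ∘ evalVec E`;
* `sum_smul_rangeProj_single` (`∑_k c_k • E e_k = E c`), `dotPairing_dualToRangeTranspose` (`= id`, needs `E² = E`),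
  `dualToRangeTranspose_dotPairing` (`= id`, needs `E² = E`);
* **`rangeTransposeEquivDual E hE : range (toLin' Eᵀ) ≃ₗ[R] Module.Dual R (range (toLin' E))`** (`_apply`).

## References
* [Conrad2004GrossZagier] B. Conrad, *Gross–Zagier revisited*, MSRI Publ. 49 (2004), §7 (finite projective modules and their duals in the
  Serre construction).
* [GortzWedhorn2020] U. Görtz, T. Wedhorn, *Algebraic Geometry I* (2nd ed.), Definition/Proposition B.15 (projective = direct summand of free;
  duals).
* Mathlib: `LinearAlgebra.Dual.Defs` (`Module.Dual`), `Data.Matrix.Mul` (`dotProduct`, `mulVec_transpose`, `dotProduct_mulVec`).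
-/

namespace Literature.Algebra.Module.IdempotentMatrix

open Matrix

variable {R : Type*} [CommRing R] {n : ℕ} (E : Matrix (Fin n) (Fin n) R)

/-- **The pairing `Eᵀ·Rⁿ → (E·Rⁿ)^∨`**, `w ↦ (v ↦ w ⬝ᵥ v)`. [cite: Conrad2004GrossZagier, §7] -/
def dotPairing : LinearMap.range (Matrix.toLin' E.transpose) →ₗ[R] Module.Dual R (LinearMap.range (Matrix.toLin' E)) :=
  LinearMap.mk₂ R (fun w v => dotProduct (w : Fin n → R) (v : Fin n → R))
    (fun w₁ w₂ v => by rw [Submodule.coe_add, add_dotProduct])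
    (fun c w v => by rw [Submodule.coe_smul, smul_dotProduct, smul_eq_mul])
    (fun w v₁ v₂ => by rw [Submodule.coe_add, dotProduct_add])
    (fun c w v => by rw [Submodule.coe_smul, dotProduct_smul, smul_eq_mul])

/-- `dotPairing E w v = w ⬝ᵥ v`. [cite: Conrad2004GrossZagier, §7] -/
@[simp]
theorem dotPairing_apply (w : LinearMap.range (Matrix.toLin' E.transpose)) (v : LinearMap.range (Matrix.toLin' E)) :
    dotPairing E w v = dotProduct (w : Fin n → R) (v : Fin n → R) := rfl

/-- `φ ↦ (φ (E e_k))_k`: the values of a linear form on the generators `E e_k` of `E·Rⁿ`. [cite: Conrad2004GrossZagier, §7] -/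
def evalVec : Module.Dual R (LinearMap.range (Matrix.toLin' E)) →ₗ[R] (Fin n → R) where
  toFun φ k := φ (rangeProj E (Pi.single k 1))
  map_add' _ _ := rfl
  map_smul' _ _ := rfl

/-- `evalVec E φ k = φ (E e_k)`. [cite: Conrad2004GrossZagier, §7] -/
@[simp]
theorem evalVec_apply (φ : Module.Dual R (LinearMap.range (Matrix.toLin' E))) (k : Fin n) :
    evalVec E φ k = φ (rangeProj E (Pi.single k 1)) := rfl

/-- **`(E·Rⁿ)^∨ → Eᵀ·Rⁿ`**, `φ ↦ Eᵀ·(φ (E e_k))_k`. [cite: Conrad2004GrossZagier, §7] -/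
def dualToRangeTranspose : Module.Dual R (LinearMap.range (Matrix.toLin' E)) →ₗ[R] LinearMap.range (Matrix.toLin' E.transpose) :=
  rangeProj E.transpose ∘ₗ evalVec E

/-- `↑(dualToRangeTranspose E φ) = Eᵀ *ᵥ evalVec E φ`. [cite: Conrad2004GrossZagier, §7] -/
theorem coe_dualToRangeTranspose (φ : Module.Dual R (LinearMap.range (Matrix.toLin' E))) :
    (dualToRangeTranspose E φ : Fin n → R) = E.transpose *ᵥ evalVec E φ := by
  change Matrix.toLin' E.transpose (evalVec E φ) = _
  rw [Matrix.toLin'_apply]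

/-- `↑(rangeProj E c) = E *ᵥ c`. [cite: Conrad2004GrossZagier, §7] -/
theorem coe_rangeProj (c : Fin n → R) : (rangeProj E c : Fin n → R) = E *ᵥ c := Matrix.toLin'_apply E c

/-- `∑_k c_k • E e_k = E c` in `E·Rⁿ`. [cite: Conrad2004GrossZagier, §7] -/
theorem sum_smul_rangeProj_single (c : Fin n → R) : ∑ k : Fin n, c k • rangeProj E (Pi.single k 1) = rangeProj E c := by
  have hc : ∑ k : Fin n, c k • (Pi.single k (1 : R) : Fin n → R) = c := by
    conv_rhs => rw [← Finset.univ_sum_single c]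
    refine Finset.sum_congr rfl fun k _ => ?_
    ext j
    by_cases h : j = k
    · subst h; simp
    · simp [h]
  calc ∑ k : Fin n, c k • rangeProj E (Pi.single k 1) = rangeProj E (∑ k : Fin n, c k • (Pi.single k (1 : R) : Fin n → R)) := by
        rw [map_sum]
        exact Finset.sum_congr rfl fun k _ => by rw [map_smul]
    _ = rangeProj E c := by rw [hc]

/-- An element `v ∈ E·Rⁿ` is fixed by `E`: `E *ᵥ v = v` (idempotent `E`). [cite: Conrad2004GrossZagier, §7] -/
theorem mulVec_coe_eq_of_mem (hE : E * E = E) (v : LinearMap.range (Matrix.toLin' E)) : E *ᵥ (v : Fin n → R) = v := by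
  obtain ⟨_, g, rfl⟩ := v
  change E *ᵥ (Matrix.toLin' E g) = Matrix.toLin' E g
  rw [Matrix.toLin'_apply, mulVec_mulVec, hE]

/-- `dotPairing ∘ dualToRangeTranspose = id`: `Eᵀ(φ(E e_k))_k ⬝ v = (φ(E e_k))_k ⬝ E v = ∑_k φ(E e_k) v_k = φ(E v) = φ(v)`.
[cite: Conrad2004GrossZagier, §7] -/
theorem dotPairing_dualToRangeTranspose (hE : E * E = E) (φ : Module.Dual R (LinearMap.range (Matrix.toLin' E))) :
    dotPairing E (dualToRangeTranspose E φ) = φ := by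
  refine LinearMap.ext fun v => ?_
  rw [dotPairing_apply, coe_dualToRangeTranspose, mulVec_transpose, ← dotProduct_mulVec, mulVec_coe_eq_of_mem E hE]
  have hv : rangeProj E (v : Fin n → R) = v := Subtype.ext (by rw [coe_rangeProj, mulVec_coe_eq_of_mem E hE])
  conv_rhs => rw [← hv, ← sum_smul_rangeProj_single, map_sum]
  simp only [dotProduct, evalVec_apply, map_smul, smul_eq_mul, mul_comm]

/-- `dualToRangeTranspose ∘ dotPairing = id`: `(w ⬝ E e_k)_k = (wE)ᵀ = Eᵀ w = w` for `w ∈ Eᵀ·Rⁿ`. [cite: Conrad2004GrossZagier, §7] -/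
theorem dualToRangeTranspose_dotPairing (hE : E * E = E) (w : LinearMap.range (Matrix.toLin' E.transpose)) :
    dualToRangeTranspose E (dotPairing E w) = w := by
  have hEt : E.transpose * E.transpose = E.transpose := by rw [← transpose_mul, hE]
  have hw : E.transpose *ᵥ (w : Fin n → R) = w := mulVec_coe_eq_of_mem E.transpose hEt w
  have hev : evalVec E (dotPairing E w) = (w : Fin n → R) := by
    funext k
    rw [evalVec_apply, dotPairing_apply, coe_rangeProj, dotProduct_mulVec, dotProduct_single_one, ← mulVec_transpose, hw]
  apply Subtype.ext
  rw [coe_dualToRangeTranspose, hev, hw]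

/-- **`Eᵀ·Rⁿ ≃ₗ[R] (E·Rⁿ)^∨`**: the dual of the presented projective module `𝔟 = E·Rⁿ` is presented by the transpose `Eᵀ`.
[cite: Conrad2004GrossZagier, §7] [cite: GortzWedhorn2020, Definition/Proposition B.15] -/
noncomputable def rangeTransposeEquivDual (hE : E * E = E) :
    LinearMap.range (Matrix.toLin' E.transpose) ≃ₗ[R] Module.Dual R (LinearMap.range (Matrix.toLin' E)) :=
  LinearEquiv.ofLinear (dotPairing E) (dualToRangeTranspose E) (LinearMap.ext (dotPairing_dualToRangeTranspose E hE))
    (LinearMap.ext (dualToRangeTranspose_dotPairing E hE))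

/-- `rangeTransposeEquivDual E hE w v = w ⬝ᵥ v`. [cite: Conrad2004GrossZagier, §7] -/
theorem rangeTransposeEquivDual_apply (hE : E * E = E) (w : LinearMap.range (Matrix.toLin' E.transpose)) (v : LinearMap.range (Matrix.toLin' E)) :
    rangeTransposeEquivDual E hE w v = dotProduct (w : Fin n → R) (v : Fin n → R) := rfl

end Literature.Algebra.Module.IdempotentMatrix
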